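import Literature.Probability.RandomPlanarGeometry.HexSAWRotStripSurfaceZigzag
import HarnessLib

/-!
# The rotated strip of height one is degenerate: `B^{→}_{1,W}(x_c, y) ≤ x_c² y + x_c³ y²` for every `W`
# (kernel certificate of the lane note E-UB-H1: the face UB cannot hold with `1 ≤ H`)

Topic `Literature/Probability/RandomPlanarGeometry` (continues `HexSAWRotStripSurfaceZigzag.lean` — `HV.rotStripBRy`, the repaired
face `HV.RotByUnboundedLarge` with `2 ≤ H`).  Source frame: N. R. Beaton, *The critical surface fugacity of self-avoiding walks on a
rotated honeycomb lattice*, J. Phys. A 47 (2014) 075003, §2.2 (the domains `D_{T,L}`): in the tree's right-started normalisation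
`D(H, W) = HV.rotStripV H W`, the row at Beaton height `1` is a set of pairwise non-adjacent dimers, so for `H = 1` the only walks from
`a⁺` to the top are `a⁺ → (−1,0,↓) → β` and `a⁺ → (−1,0,↓) → (−1,1,↑) → β`.

## What is proved (HOME build of a-p2 g7, 2026-08-23; lane note E-UB-H1, lead r53 (2))

* `rotTop_one_cases` — every right-started top walk of `D(1, W) ∖ {a⁻}` is one of the two explicit lists;
* **`rotStripBRy_one_le`** — `B^{→}_{1,W}(x_c, y) ≤ x_c² y + x_c³ y²` for all `W` and `y ≥ 0`;
* **`not_rotByUnboundedLarge_one`** — the `1 ≤ H` typing of the face UB is false: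
  `¬ ∀ H y, 1 ≤ H → 2 + √2 < y → ¬ BddAbove (range W ↦ B^{→}_{H,W+1}(x_c,y))`.
-/

noncomputable section

open Finset Filter Topology Literature.Probability.LatticeModels Literature.Probability.Percolation

namespace Literature.Probability.RandomPlanarGeometry.SAW.HV

/-- The first top walk of `D(1, W)`: `a⁻, a⁺, (−1,0,↓)`, exit `(−1,0,↑)`. [cite: Beaton2014RotatedHoneycomb, §2.2 (D_{T,L})] -/
def rotOneWalk₁ : List HV := [wOut, hvOrigin, (-1, 0, true), (-1, 0, false)]

/-- The second top walk of `D(1, W)` (`W ≥ 2`): `a⁻, a⁺, (−1,0,↓), (−1,1,↑)`, exit `(−2,1,↓)`. [cite: Beaton2014RotatedHoneycomb, §2.2 (D_{T,L})] -/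
def rotOneWalk₂ : List HV := [wOut, hvOrigin, (-1, 0, true), (-1, 1, false), (-2, 1, true)]

/-- A neighbour of `a⁺` at Beaton height `1` is `(−1, 0, ↓)`. [cite: Beaton2014RotatedHoneycomb, §2.2] -/
theorem eq_of_adj_hvOrigin_of_xi {v : HV} (h : hvGraph.Adj hvOrigin v) (hv : xi v = -1) : v = (-1, 0, true) := by
  obtain ⟨a, b, c⟩ := v
  cases c <;> simp [hvGraph_adj, AdjRel, hvOrigin, xi] at h hv ⊢
  all_goals omega

/-- The neighbours of `(−1, 0, ↓)`: at height `2` it is `(−1, 0, ↑)`, at height `1` it is `(−1, 1, ↑)` (the third one is `a⁺`).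
[cite: Beaton2014RotatedHoneycomb, §2.2] -/
theorem eq_of_adj_q1_of_xi {v : HV} (h : hvGraph.Adj ((-1 : ℤ), (0 : ℤ), true) v) :
    (xi v = -2 → v = (-1, 0, false)) ∧ (xi v = -1 → v = (-1, 1, false)) := by
  obtain ⟨a, b, c⟩ := v
  cases c <;> simp [hvGraph_adj, AdjRel, xi] at h ⊢
  all_goals omega

/-- The neighbours of `(−1, 1, ↑)`: at height `2` it is `(−2, 1, ↓)`, at height `1` it is `(−1, 0, ↓)`.
[cite: Beaton2014RotatedHoneycomb, §2.2] -/
theorem eq_of_adj_q2_of_xi {v : HV} (h : hvGraph.Adj ((-1 : ℤ), (1 : ℤ), false) v) :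
    (xi v = -2 → v = (-2, 1, true)) ∧ (xi v = -1 → v = (-1, 0, true)) := by
  obtain ⟨a, b, c⟩ := v
  cases c <;> simp [hvGraph_adj, AdjRel, xi] at h ⊢
  all_goals omega

/-- An inner vertex of a walk of `D(1, W) ∖ {a⁻}` other than `a⁺` has Beaton height `1`. [cite: Beaton2014RotatedHoneycomb, §2.2] -/
theorem xi_of_mem_rotStripV_one {Wd : ℕ} {v : HV} (hv : v ∈ (rotStripV 1 Wd).erase wOut) (hO : v ≠ hvOrigin) : xi v = -1 := by
  rw [mem_erase, mem_rotStripV_iff] at hv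
  obtain ⟨hw, h | h | h⟩ := hv
  · exact absurd h hw
  · exact absurd h hO
  · push_cast at h; omega

/-- **Every right-started top walk of `D(1, W) ∖ {a⁻}` is `rotOneWalk₁` or `rotOneWalk₂`.**
[cite: Beaton2014RotatedHoneycomb, §2.2 (D_{T,L}; here T = 2 in Beaton's normalisation)] -/
theorem rotTop_one_cases {Wd : ℕ} {P : List HV}
    (hP : P ∈ (midWalks ((rotStripV 1 Wd).erase wOut)).filter fun P => IsRotTopDart 1 (finalDart P)) :
    P = rotOneWalk₁ ∨ P = rotOneWalk₂ := by
  rw [mem_filter, mem_midWalks_iff] at hP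
  obtain ⟨hmw, htop⟩ := hP
  obtain ⟨Q, rfl⟩ := hmw.exists_eq_cons
  obtain ⟨hc, -, -, hV, hnd, -⟩ := hmw
  rw [IsRotTopDart] at htop
  push_cast at htop
  rcases Q with _ | ⟨q₁, Q⟩
  · -- the trivial walk does not end on the top
    simp [finalDart, xi_wOut] at htop
  rcases Q with _ | ⟨q₂, Q⟩
  · -- exit straight from `a⁺`: not a top dart (`ξ(a⁺) = 0`)
    simp [finalDart, xi_hvOrigin] at htop
  -- `q₁` is an inner vertex at height 1 adjacent to `a⁺`
  have hc1 : hvGraph.Adj hvOrigin q₁ := (List.isChain_cons_cons.1 (List.isChain_cons_cons.1 hc).2).1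
  have hc2 : List.IsChain hvGraph.Adj (q₁ :: q₂ :: Q) := (List.isChain_cons_cons.1 (List.isChain_cons_cons.1 hc).2).2
  have hin : inner (wOut :: hvOrigin :: q₁ :: q₂ :: Q) = hvOrigin :: q₁ :: (q₂ :: Q).dropLast := by
    simp [inner]
  rw [hin] at hV hnd
  have hq₁O : q₁ ≠ hvOrigin := by
    intro h; subst h; exact (List.nodup_cons.1 hnd).1 (by simp)
  have hq₁ : q₁ = (-1, 0, true) :=
    eq_of_adj_hvOrigin_of_xi hc1 (xi_of_mem_rotStripV_one (hV q₁ (by simp)) hq₁O)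
  subst hq₁
  have hc3 : hvGraph.Adj ((-1 : ℤ), (0 : ℤ), true) q₂ := (List.isChain_cons_cons.1 hc2).1
  rcases Q with _ | ⟨q₃, Q⟩
  · -- exit from `q₁`: the top dart forces `q₂ = (−1, 0, ↑)`
    left
    have hξ : xi q₂ = -2 := by simp [finalDart] at htop; omega
    rw [(eq_of_adj_q1_of_xi hc3).1 hξ]; rfl
  -- `q₂` is inner, at height 1, not `a⁺` ⇒ `q₂ = (−1, 1, ↑)`
  have hq₂O : q₂ ≠ hvOrigin := by
    intro h; subst h; exact (List.nodup_cons.1 hnd).1 (by simp)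
  have hq₂ : q₂ = (-1, 1, false) :=
    (eq_of_adj_q1_of_xi hc3).2 (xi_of_mem_rotStripV_one (hV q₂ (by simp)) hq₂O)
  subst hq₂
  have hc4 : hvGraph.Adj ((-1 : ℤ), (1 : ℤ), false) q₃ := (List.isChain_cons_cons.1 (List.isChain_cons_cons.1 hc2).2).1
  rcases Q with _ | ⟨q₄, Q⟩
  · -- exit from `q₂`: the top dart forces `q₃ = (−2, 1, ↓)`
    right
    have hξ : xi q₃ = -2 := by simp [finalDart] at htop; omega
    rw [(eq_of_adj_q2_of_xi hc4).1 hξ]; rfl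
  -- a fourth inner vertex would be `q₁` again
  exfalso
  have hq₃O : q₃ ≠ hvOrigin := by
    intro h; subst h; exact (List.nodup_cons.1 hnd).1 (by simp)
  have hq₃ : q₃ = (-1, 0, true) :=
    (eq_of_adj_q2_of_xi hc4).2 (xi_of_mem_rotStripV_one (hV q₃ (by simp)) hq₃O)
  subst hq₃
  have h2 := (List.nodup_cons.1 (List.nodup_cons.1 hnd).2).1
  exact h2 (by simp)

/-- **`B^{→}_{1,W}(x_c, y) ≤ x_c² y + x_c³ y²`** for every `W` and `y ≥ 0` (with equality for `W ≥ 2`): the height-one rotated strip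
carries no zig-zag. [cite: Beaton2014RotatedHoneycomb, §2.2 (D_{T,L})] -/
theorem rotStripBRy_one_le (Wd : ℕ) {y : ℝ} (hy : 0 ≤ y) :
    rotStripBRy 1 Wd y ≤ hexCriticalFugacity ^ 2 * y + hexCriticalFugacity ^ 3 * y ^ 2 := by
  have hx : 0 < hexCriticalFugacity := hexCriticalFugacity_pos_lt_one.1
  have hne : rotOneWalk₁ ≠ rotOneWalk₂ := by decide
  rw [rotStripBRy, rotGFy]
  calc ∑ P ∈ (midWalks ((rotStripV 1 Wd).erase wOut)).filter (fun P => IsRotTopDart 1 (finalDart P)),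
        hexCriticalFugacity ^ mwLen P * y ^ topContacts 1 P
      ≤ ∑ P ∈ ({rotOneWalk₁, rotOneWalk₂} : Finset (List HV)), hexCriticalFugacity ^ mwLen P * y ^ topContacts 1 P := by
        refine sum_le_sum_of_subset_of_nonneg (fun P hP => ?_) fun _ _ _ => by positivity
        rcases rotTop_one_cases hP with rfl | rfl <;> simp
    _ = hexCriticalFugacity ^ 2 * y + hexCriticalFugacity ^ 3 * y ^ 2 := by
        rw [sum_pair hne]
        have h1 : mwLen rotOneWalk₁ = 2 := rfl
        have h2 : mwLen rotOneWalk₂ = 3 := rfl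
        have h3 : topContacts 1 rotOneWalk₁ = 1 := by decide
        have h4 : topContacts 1 rotOneWalk₂ = 2 := by decide
        rw [h1, h2, h3, h4, pow_one]

/-- **Lane note E-UB-H1, certified**: the face UB typed with `1 ≤ H` is false (take `H = 1`, `y = 4 > 2 + √2`).
[cite: Beaton2014RotatedHoneycomb, §2.2 (D_{T,L})] -/
theorem not_rotByUnboundedLarge_one :
    ¬ ∀ (H : ℕ) (y : ℝ), 1 ≤ H → 2 + Real.sqrt 2 < y → ¬ BddAbove (Set.range fun Wd : ℕ => rotStripBRy H (Wd + 1) y) := by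
  intro h
  have hs : Real.sqrt 2 < 2 := by
    rw [show (2 : ℝ) = Real.sqrt 4 by rw [show (4 : ℝ) = 2 ^ 2 by norm_num, Real.sqrt_sq (by norm_num)]]
    exact Real.sqrt_lt_sqrt (by norm_num) (by norm_num)
  refine h 1 4 le_rfl (by linarith) ⟨hexCriticalFugacity ^ 2 * 4 + hexCriticalFugacity ^ 3 * 4 ^ 2, ?_⟩
  rintro _ ⟨Wd, rfl⟩
  exact rotStripBRy_one_le (Wd + 1) (by norm_num)

end Literature.Probability.RandomPlanarGeometry.SAW.HV
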